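import Mathlib
import Summits.Ventures.PercRepro2.UniversalAlignedParAlpha

/-! # The level-aligned package under parallel composition, II: the relays `β k` and the package
(seat mine-b, cell pub-perc-repro2; MINE-B.md §29.3)

The relays `β k` of the parallel product `X ∗ Y`: the slab `b u ≤ k` uses `β (k − b u)` of `Y` when
`r u = 0` (then `r' v ≥ 1`) and `α (k − b u)` of `Y` otherwise (no `Y`-avoidance is needed when `u` is
red-positive); `b u > k` with `r' v ≥ 1` is fixed; `b u > k` with `r' v = 0` moves the first coordinate by
`β k` of `X`.  With the assignment and the relays `α k` of UniversalAlignedParAlpha.lean this is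
`PackageL.par`: **the level-aligned package is closed under parallel composition**. -/

namespace Summit.Ventures.PercRepro2.UHClosure

open Finset

variable {X Y : Type*} [Preorder X] [Preorder Y] [Fintype X] [Fintype Y]
variable {r b : X → ℕ} {r' b' : Y → ℕ} (P : PackageL r b) (Q : PackageL r' b')

/-! ### The level relays `β k` of the product -/

/-- the level relay `β k` of the parallel product -/
def parBeta (k : ℕ) (z : X × Y) : X × Y :=
  if b z.1 ≤ k then (if r z.1 = 0 then (z.1, Q.β (k - b z.1) z.2) else (z.1, Q.α (k - b z.1) z.2))
  else if 1 ≤ r' z.2 then z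
  else (P.β k z.1, z.2)

/-- the four families of `parBeta` -/
lemma parBeta_cases (k : ℕ) (z : X × Y) :
    (b z.1 ≤ k ∧ r z.1 = 0 ∧ parBeta P Q k z = (z.1, Q.β (k - b z.1) z.2)) ∨
    (b z.1 ≤ k ∧ r z.1 ≠ 0 ∧ parBeta P Q k z = (z.1, Q.α (k - b z.1) z.2)) ∨
    (¬ b z.1 ≤ k ∧ 1 ≤ r' z.2 ∧ parBeta P Q k z = z) ∨
    (¬ b z.1 ≤ k ∧ ¬ 1 ≤ r' z.2 ∧ parBeta P Q k z = (P.β k z.1, z.2)) := by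
  unfold parBeta
  by_cases h1 : b z.1 ≤ k
  · by_cases h0 : r z.1 = 0
    · left; exact ⟨h1, h0, by rw [if_pos h1, if_pos h0]⟩
    · right; left; exact ⟨h1, h0, by rw [if_pos h1, if_neg h0]⟩
  · by_cases h2 : 1 ≤ r' z.2
    · right; right; left; exact ⟨h1, h2, by rw [if_neg h1, if_pos h2]⟩
    · right; right; right; exact ⟨h1, h2, by rw [if_neg h1, if_neg h2]⟩

omit [Preorder X] [Preorder Y] [Fintype X] [Fintype Y] in
/-- a red label `≥ 1` of the product -/
lemma parR_pos {z : X × Y} (h : 1 ≤ parR r r' z) : 1 ≤ r z.1 + r' z.2 := by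
  simp only [parR] at h; exact h

/-- the second coordinate of a `parBeta` image is red-positive unless the element is moved in `X` -/
lemma parBeta_snd_red (k : ℕ) (z : X × Y) (hr : 1 ≤ parR r r' z) (hz : k < parB b b' z) (h1 : b z.1 ≤ k) :
    1 ≤ r' (parBeta P Q k z).2 := by
  have hr := parR_pos hr
  have hz := parB_gt hz
  rcases parBeta_cases P Q k z with ⟨-, h0, e⟩ | ⟨-, h0, e⟩ | ⟨h1', -, -⟩ | ⟨h1', -, -⟩
  · rw [e]; exact (Q.β_spec (k - b z.1) z.2 (by omega) (by omega)).2.1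
  · rw [e]; exact (Q.α_spec (k - b z.1) z.2 (by omega)).2.1
  · exact absurd h1 h1'
  · exact absurd h1 h1'

/-- `parBeta k` is injective on `{r ≥ 1, b > k}` -/
theorem parBeta_inj (k : ℕ) (z z' : X × Y) (hr : 1 ≤ parR r r' z) (hz : k < parB b b' z)
    (hr' : 1 ≤ parR r r' z') (hz' : k < parB b b' z') (h : parBeta P Q k z = parBeta P Q k z') : z = z' := by
  have hr := parR_pos hr
  have hr' := parR_pos hr'
  have hz := parB_gt hz
  have hz' := parB_gt hz'
  rcases parBeta_cases P Q k z with ⟨h1, h0, e⟩ | ⟨h1, h0, e⟩ | ⟨h1, h2, e⟩ | ⟨h1, h2, e⟩ <;>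
  rcases parBeta_cases P Q k z' with ⟨h1', h0', e'⟩ | ⟨h1', h0', e'⟩ | ⟨h1', h2', e'⟩ | ⟨h1', h2', e'⟩ <;>
  rw [e, e'] at h
  · obtain ⟨e1, e2⟩ := Prod.mk.inj h
    rw [← e1] at e2
    exact Prod.ext e1 (Q.β_inj (k - b z.1) z.2 z'.2 (by omega) (by omega) (by omega) (by rw [e1]; omega) e2)
  · exfalso; have e1 : z.1 = z'.1 := (Prod.mk.inj h).1; rw [e1] at h0; exact h0' h0
  · exfalso; have e1 : z.1 = z'.1 := (Prod.mk.inj h).1; rw [e1] at h1; exact h1' h1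
  · exfalso
    have e2 : Q.β (k - b z.1) z.2 = z'.2 := (Prod.mk.inj h).2
    have := (Q.β_spec (k - b z.1) z.2 (by omega) (by omega)).2.1
    rw [e2] at this; exact h2' this
  · exfalso; have e1 : z.1 = z'.1 := (Prod.mk.inj h).1; rw [e1] at h0; exact h0 h0'
  · obtain ⟨e1, e2⟩ := Prod.mk.inj h
    rw [← e1] at e2
    exact Prod.ext e1 (Q.α_inj (k - b z.1) z.2 z'.2 (by omega) (by rw [e1]; omega) e2)
  · exfalso; have e1 : z.1 = z'.1 := (Prod.mk.inj h).1; rw [e1] at h1; exact h1' h1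
  · exfalso
    have e2 : Q.α (k - b z.1) z.2 = z'.2 := (Prod.mk.inj h).2
    have := (Q.α_spec (k - b z.1) z.2 (by omega)).2.1
    rw [e2] at this; exact h2' this
  · exfalso; have e1 : z.1 = z'.1 := (Prod.mk.inj h).1; rw [← e1] at h1'; exact h1 h1'
  · exfalso; have e1 : z.1 = z'.1 := (Prod.mk.inj h).1; rw [← e1] at h1'; exact h1 h1'
  · exact h
  · exfalso; have e2 : z.2 = z'.2 := (Prod.mk.inj h).2; rw [e2] at h2; exact h2' h2
  · exfalso
    have e2 : z.2 = Q.β (k - b z'.1) z'.2 := (Prod.mk.inj h).2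
    have := (Q.β_spec (k - b z'.1) z'.2 (by omega) (by omega)).2.1
    rw [← e2] at this; exact h2 this
  · exfalso
    have e2 : z.2 = Q.α (k - b z'.1) z'.2 := (Prod.mk.inj h).2
    have := (Q.α_spec (k - b z'.1) z'.2 (by omega)).2.1
    rw [← e2] at this; exact h2 this
  · exfalso; have e2 : z.2 = z'.2 := (Prod.mk.inj h).2; rw [← e2] at h2'; exact h2 h2'
  · obtain ⟨e1, e2⟩ := Prod.mk.inj h
    exact Prod.ext (P.β_inj k z.1 z'.1 (by omega) (by omega) (by omega) (by omega) e1) e2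

/-- `parBeta k` is downward, red `≥ 1`, blue drop `≤ 1` -/
theorem parBeta_spec (k : ℕ) (z : X × Y) (hr : 1 ≤ parR r r' z) (hz : k < parB b b' z) :
    parBeta P Q k z ≤ z ∧ 1 ≤ parR r r' (parBeta P Q k z) ∧ parB b b' z ≤ parB b b' (parBeta P Q k z) + 1 := by
  have hr := parR_pos hr
  have hz := parB_gt hz
  rcases parBeta_cases P Q k z with ⟨h1, h0, e⟩ | ⟨h1, h0, e⟩ | ⟨h1, h2, e⟩ | ⟨h1, h2, e⟩ <;> rw [e]
  · obtain ⟨l2, r2, d2⟩ := Q.β_spec (k - b z.1) z.2 (by omega) (by omega)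
    refine ⟨Prod.mk_le_mk.2 ⟨le_rfl, l2⟩, ?_, ?_⟩
    · simp only [parR]; omega
    · simp only [parB]; omega
  · obtain ⟨l2, r2, d2⟩ := Q.α_spec (k - b z.1) z.2 (by omega)
    refine ⟨Prod.mk_le_mk.2 ⟨le_rfl, l2⟩, ?_, ?_⟩
    · simp only [parR]; omega
    · simp only [parB]; omega
  · exact ⟨le_rfl, by simp only [parR]; omega, by simp only [parB]; omega⟩
  · obtain ⟨l1, r1, d1⟩ := P.β_spec k z.1 (by omega) (by omega)
    refine ⟨Prod.mk_le_mk.2 ⟨l1, le_rfl⟩, ?_, ?_⟩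
    · simp only [parR]; omega
    · simp only [parB]; omega

/-- `parBeta k` avoids the images of the slots of index `≤ k` -/
theorem parBeta_avoid (k : ℕ) (z : X × Y) (hr : 1 ≤ parR r r' z) (hz : k < parB b b' z)
    (p : SlotL (USrc (parR r r') (parB b b')) (parB b b')) (hp : p.1.2.val ≤ k) :
    parBeta P Q k z ≠ parAssign r b r' b' P.f Q.f p := by
  intro he
  have hr := parR_pos hr
  have hz := parB_gt hz
  have hx0 := src_fst r b r' b' p.1.1.2.1
  have hy0 := src_snd r b r' b' p.1.1.2.1
  unfold parAssign at he
  rcases parBeta_cases P Q k z with ⟨h1, h0, e⟩ | ⟨h1, h0, e⟩ | ⟨h1, h2, e⟩ | ⟨h1, h2, e⟩ <;> rw [e] at he <;>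
  by_cases hi : p.1.2.val < b p.1.1.1.1
  · -- slab (source first coordinate) vs an `X`-slot: second coordinates red `≥ 1` and `0`
    rw [dif_pos hi] at he
    obtain ⟨-, e2⟩ := Prod.mk.inj he
    have := (Q.β_spec (k - b z.1) z.2 (by omega) (by omega)).2.1
    rw [e2] at this; omega
  · -- slab (source first coordinate) vs a `Y`-slot: `β (k − b u)` avoids the `Y`-index `≤ k − b u`
    rw [dif_neg hi] at he
    obtain ⟨e1, e2⟩ := Prod.mk.inj he
    have hb : b p.1.1.1.1 = b z.1 := by rw [e1]
    refine Q.β_avoid (k - b z.1) z.2 (by omega) (by omega) (slotY r b r' b' p hi) ?_ e2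
    rw [slotY_idx]; omega
  · -- slab (red-positive first coordinate) vs an `X`-slot
    rw [dif_pos hi] at he
    obtain ⟨-, e2⟩ := Prod.mk.inj he
    have := (Q.α_spec (k - b z.1) z.2 (by omega)).2.1
    rw [e2] at this; omega
  · -- slab (red-positive first coordinate) vs a `Y`-slot: the first coordinate is a source there
    rw [dif_neg hi] at he
    obtain ⟨e1, -⟩ := Prod.mk.inj he
    rw [e1] at h0; exact h0 hx0
  · -- fixed vs an `X`-slot
    rw [dif_pos hi] at he
    obtain ⟨-, e2⟩ := Prod.mk.inj he
    rw [e2] at h2; omega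
  · -- fixed vs a `Y`-slot: the index is `≥ b u > k`
    rw [dif_neg hi] at he
    obtain ⟨e1, -⟩ := Prod.mk.inj he
    have hb : b p.1.1.1.1 = b z.1 := by rw [e1]
    omega
  · -- moved vs an `X`-slot: `β k` avoids the slots of index `≤ k`
    rw [dif_pos hi] at he
    obtain ⟨e1, -⟩ := Prod.mk.inj he
    exact P.β_avoid k z.1 (by omega) (by omega) (slotX r b r' b' p hi) (by rw [slotX_idx]; exact hp) e1
  · -- moved vs a `Y`-slot: second coordinates red `0` and `1`
    rw [dif_neg hi] at he
    obtain ⟨-, e2⟩ := Prod.mk.inj he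
    have := (Q.f_spec (slotY r b r' b' p hi)).2.1
    rw [← e2] at this; omega

/-- **the parallel product of two level-aligned packages** -/
noncomputable def PackageL.par : PackageL (parR r r') (parB b b') where
  f := parAssign r b r' b' P.f Q.f
  f_inj := parAssign_inj P Q
  f_spec := parAssign_spec P Q
  α := parAlpha P Q
  α_inj := parAlpha_inj P Q
  α_spec := parAlpha_spec P Q
  α_avoid := parAlpha_avoid P Q
  α_src := parAlpha_src P Q
  β := parBeta P Q
  β_inj := parBeta_inj P Q
  β_spec := parBeta_spec P Q
  β_avoid := parBeta_avoid P Q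

end Summit.Ventures.PercRepro2.UHClosure
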